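import Summits.CriticalPhenomena.PercolationContinuityZ3.Theorems.Transplant.StatementHcp
import Literature.MathematicalPhysics.StatisticalMechanics.BarlowCoordination
import HarnessLib
import HarnessLib.Audit

/-!
# The contact graphs of the ideal Barlow stackings (close-packed polytypes): definition from the Literature ball centres `barlowPos`,
# the combinatorial shell, and DEFINITION-FAITHFULNESS of the lane's hcp carrier (`Hcp.hcpGraph ≃g` the contact graph of the `ABAB…` packing)

builds on p205010 (kernel theorem, internal audit signed; external expert review pending) — nothing in this file uses p205010.
Status sentence (coordinator 2026-08-20T04:30Z): "θ(p_c) = 0 on ℤ^d, all d ≥ 2 — kernel-verified (Lean 4/Mathlib, standard axioms); internal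
adversarial audit SIGNED 2026-08-20 04:29Z; external expert review pending."
Lane `prim-bschramm-*`, seat `prim-bschramm-stmt` (gen 11); source statements: postcont-2 `Targets.lean` §gen-47 (TARGETS 2t / 2t′, `barlowGraph'`,
`hcpGraph'`).  Literature inputs (all tree theorems): `barlowPos a h s k i j = i u + j v + (haggLabel s k) w + k h e₃`
(L-SM/BarlowStacking.lean), the shell theorem `dist_barlowPos_eq_iff` and `le_dist_barlowPos_of_ideal` (L-SM/BarlowCoordination.lean; `IsHaggSeq`,
`alternatingHagg` from L-SM/HaggStacking.lean).

* §1 `Barlow.idealSpacing = √(2/3)` (touching layers for unit balls), `Barlow.site s v` (the centre of ball `v = (k, i, j)`), `Barlow.site_injective`,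
  **`Barlow.contactGraph s`** (adjacent iff the centres are at distance `1`), `contactGraph_adj_iff_dist`, **`contactGraph_adj_iff`** (the twelve
  contacts: six in the layer, three above with offsets `threeOffsets (−s k)`, three below with `threeOffsets (s (k−1))`), `Barlow.adj_bound`
  (coordinates move by `≤ 1`), `Barlow.locallyFinite`;
* §2 **`Hcp.contactIso : Hcp.hcpGraph ≃g Barlow.contactGraph alternatingHagg`** — the lane's combinatorial hcp (`Transplant/HcpNoConc.lean`: vertices
  `(i, j, z) ∈ ℤ³`, A/B layers by the parity of `z`, the bond table `Hcp.bonds`) IS the contact graph of the hexagonal close packing of unit balls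
  (coordinates `(i, j, z) ↦ (k, i, j) = (z, i, j)`); hence `hcpOwnCriticalContinuity_iff_contact` (TARGET 2t in the metric vocabulary);
* the scope facts for every (periodic) stacking and TARGET 2t′ `BarlowStackingCriticalContinuity` are the companion file `Transplant/BarlowPolytypes.lean`.
[cite: ConwaySloane1999, Ch. 1 §1.3 and Ch. 4 §6.1] [cite: HalesDSP2012, §1.3] [cite: BenjaminiSchramm1996, Conj. 4 and §2] [cite: LyonsPeres2016, §6.1 and Thm. 7.6]
-/

noncomputable section

namespace Summit.CriticalPhenomena.PercolationContinuityZ3.Theorems.Transplant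

open MeasureTheory Filter Literature.Probability.Percolation Literature.Probability.LatticeModels
open Literature.Barriers.CriticalPhenomena (IsQuasiTransitive IsGraphAmenable HasExponentialGrowth graphBall ballVolume graphBall_finite
  hasExponentialGrowth_of_not_isGraphAmenable eventually_pow_lt_const_pow BurtonKeane1989_atMostOneInfiniteCluster_holds
  countable_of_connected_of_locallyFinite)
open Literature.MathematicalPhysics.StatisticalMechanics (barlowPos barlowStacking IsHaggSeq alternatingHagg constHagg sixOffsets threeOffsets
  isHaggSeq_alternating isHaggSeq_const dist_barlowPos_eq_iff le_dist_barlowPos_of_ideal)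

namespace Barlow

variable {s : ℤ → ℤ}

/-! ## §1 The contact graph of an ideal Barlow stacking -/

/-- The ideal layer spacing `h = √(2/3)` for unit in-layer spacing (adjacent layers touch). [cite: HalesDSP2012, §1.3] -/
def idealSpacing : ℝ := Real.sqrt (2 / 3)

/-- `h² = ⅔ · 1²` — the hypothesis `hh` of the Literature shell theorem. [folklore] -/
theorem idealSpacing_sq : idealSpacing ^ 2 = 2 / 3 * (1 : ℝ) ^ 2 := by
  rw [idealSpacing, Real.sq_sqrt (by norm_num)]; norm_num

/-- The centre of the ball `v = (k, i, j)` (layer `k`, triangular coordinates `(i, j)`) of the ideal stacking coded by `s`: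
`barlowPos 1 √(2/3) s k i j`. [cite: HalesDSP2012, §1.3] -/
def site (s : ℤ → ℤ) (v : ℤ × ℤ × ℤ) : EuclideanSpace ℝ (Fin 3) :=
  barlowPos 1 idealSpacing s v.1 v.2.1 v.2.2

/-- Every centre lies in the stacking `barlowStacking 1 √(2/3) s`. [folklore] -/
theorem site_mem (s : ℤ → ℤ) (v : ℤ × ℤ × ℤ) : site s v ∈ barlowStacking 1 idealSpacing s :=
  ⟨v.1, v.2.1, v.2.2, rfl⟩

/-- Every point of the stacking is a centre `site s v`. [folklore] -/
theorem exists_site_eq {x : EuclideanSpace ℝ (Fin 3)} (hx : x ∈ barlowStacking 1 idealSpacing s) : ∃ v, site s v = x := by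
  obtain ⟨k, i, j, rfl⟩ := hx
  exact ⟨(k, i, j), rfl⟩

/-- Distinct labels are distinct centres (ideal packing: distinct centres are at distance `≥ 1`). [cite: HalesDSP2012, §1.3] -/
theorem site_injective (hs : IsHaggSeq s) : Function.Injective (site s) := by
  intro v w h
  by_contra hne
  have hne' : (v.1, v.2.1, v.2.2) ≠ (w.1, w.2.1, w.2.2) := by simpa using hne
  have h1 : (1 : ℝ) ≤ dist (site s v) (site s w) := le_dist_barlowPos_of_ideal hs one_pos idealSpacing_sq hne'
  rw [h, dist_self] at h1
  exact absurd h1 (by norm_num)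

/-- **The contact graph of the ideal Barlow stacking coded by `s`**: balls `v`, `w` are adjacent iff their centres are at distance exactly `1`
(they touch). [cite: ConwaySloane1999, Ch. 1 §1.3] -/
def contactGraph (s : ℤ → ℤ) : SimpleGraph (ℤ × ℤ × ℤ) :=
  SimpleGraph.fromRel fun v w => dist (site s v) (site s w) = 1

/-- Adjacency is "distance exactly `1`" (`fromRel`'s guards are vacuous for a metric). [folklore] -/
theorem contactGraph_adj_iff_dist (s : ℤ → ℤ) (v w : ℤ × ℤ × ℤ) :
    (contactGraph s).Adj v w ↔ dist (site s v) (site s w) = 1 := by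
  rw [contactGraph, SimpleGraph.fromRel_adj]
  constructor
  · rintro ⟨-, h | h⟩
    · exact h
    · rwa [dist_comm] at h
  · intro h
    refine ⟨?_, Or.inl h⟩
    rintro rfl
    rw [dist_self] at h
    exact zero_ne_one h

/-- **The twelve contacts** (the Literature shell theorem `dist_barlowPos_eq_iff`): `(k', i', j')` touches `(k, i, j)` iff it is one of the six
in-layer neighbours (`(i − i', j − j') ∈ sixOffsets = {±(1,0), ±(0,1), ±(1,−1)}`), one of three balls of layer `k + 1`
(`(i − i', j − j') ∈ threeOffsets (−s k)`) or of three balls of layer `k − 1` (`threeOffsets (s (k−1))`). [cite: HalesDSP2012, §1.3] -/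
theorem contactGraph_adj_iff (hs : IsHaggSeq s) (k i j k' i' j' : ℤ) :
    (contactGraph s).Adj (k, i, j) (k', i', j') ↔
      (k' = k ∧ (i - i', j - j') ∈ sixOffsets) ∨
      (k' = k + 1 ∧ (i - i', j - j') ∈ threeOffsets (-s k)) ∨
      (k' = k - 1 ∧ (i - i', j - j') ∈ threeOffsets (s (k - 1))) := by
  rw [contactGraph_adj_iff_dist]
  exact dist_barlowPos_eq_iff hs one_pos idealSpacing_sq k i j k' i' j'

/-- The in-layer offsets have coordinates in `{−1, 0, 1}`. [folklore] -/
theorem sixOffsets_coord : ∀ PQ ∈ sixOffsets, -1 ≤ PQ.1 ∧ PQ.1 ≤ 1 ∧ -1 ≤ PQ.2 ∧ PQ.2 ≤ 1 := by decide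

/-- The adjacent-layer offsets have coordinates in `{−1, 0, 1}`. [folklore] -/
theorem threeOffsets_coord (σ : ℤ) : ∀ PQ ∈ threeOffsets σ, -1 ≤ PQ.1 ∧ PQ.1 ≤ 1 ∧ -1 ≤ PQ.2 ∧ PQ.2 ≤ 1 := by
  unfold threeOffsets; split_ifs <;> decide

/-- `(0, 0)` is an adjacent-layer offset for both letter shifts: the ball straight above / below always touches. [folklore] -/
theorem zero_mem_threeOffsets (σ : ℤ) : ((0 : ℤ), (0 : ℤ)) ∈ threeOffsets σ := by
  unfold threeOffsets; split_ifs <;> decide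

/-- Along a contact each of the three labels moves by at most one. [folklore] -/
theorem adj_bound (hs : IsHaggSeq s) {v w : ℤ × ℤ × ℤ} (h : (contactGraph s).Adj v w) :
    |w.1 - v.1| ≤ 1 ∧ |w.2.1 - v.2.1| ≤ 1 ∧ |w.2.2 - v.2.2| ≤ 1 := by
  obtain ⟨k, i, j⟩ := v
  obtain ⟨k', i', j'⟩ := w
  simp only
  rcases (contactGraph_adj_iff hs k i j k' i' j').1 h with ⟨hk, hm⟩ | ⟨hk, hm⟩ | ⟨hk, hm⟩
  · have := sixOffsets_coord _ hm
    simp only at this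
    refine ⟨?_, ?_, ?_⟩ <;> rw [abs_le] <;> constructor <;> omega
  · have := threeOffsets_coord _ _ hm
    simp only at this
    refine ⟨?_, ?_, ?_⟩ <;> rw [abs_le] <;> constructor <;> omega
  · have := threeOffsets_coord _ _ hm
    simp only at this
    refine ⟨?_, ?_, ?_⟩ <;> rw [abs_le] <;> constructor <;> omega

/-- The `27` label offsets `{−1,0,1}³`, a superset of the contact offsets. [folklore] -/
def cubeOffsets : Finset (ℤ × ℤ × ℤ) :=
  (({-1, 0, 1} : Finset ℤ) ×ˢ (({-1, 0, 1} : Finset ℤ) ×ˢ ({-1, 0, 1} : Finset ℤ)))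

/-- The neighbours of `v` are among the `27` translates `v + cubeOffsets`. [folklore] -/
theorem neighborSet_subset (hs : IsHaggSeq s) (v : ℤ × ℤ × ℤ) :
    (contactGraph s).neighborSet v ⊆ ↑(cubeOffsets.image fun d : ℤ × ℤ × ℤ => (v.1 + d.1, v.2.1 + d.2.1, v.2.2 + d.2.2)) := by
  intro w hw
  rw [SimpleGraph.mem_neighborSet] at hw
  obtain ⟨h1, h2, h3⟩ := adj_bound hs hw
  rw [Finset.coe_image, Set.mem_image]
  refine ⟨(w.1 - v.1, w.2.1 - v.2.1, w.2.2 - v.2.2), ?_, ?_⟩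
  · rw [Finset.mem_coe, cubeOffsets, Finset.mem_product, Finset.mem_product]
    simp only [Finset.mem_insert, Finset.mem_singleton]
    rw [abs_le] at h1 h2 h3
    refine ⟨by omega, by omega, by omega⟩
  · obtain ⟨k, i, j⟩ := w
    simp

/-- The contact graph of an ideal stacking is locally finite (as a `def`, from `IsHaggSeq s`; an instance for hcp below). [folklore] -/
@[reducible] def locallyFinite (hs : IsHaggSeq s) : (contactGraph s).LocallyFinite := fun v =>
  ((Finset.finite_toSet _).subset (neighborSet_subset hs v)).fintype

end Barlow

/-! ## §2 Definition-faithfulness: the lane's hcp carrier is the contact graph of the `ABAB…` packing -/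

namespace Hcp

open Barlow

/-- The letter shift seen from a layer of parity `e` (`e = true`: an A layer, `z` even): `−1` above and below an A layer, `+1` for a B layer. [folklore] -/
def sigmaOf (e : Bool) : ℤ := if e then -1 else 1

/-- For the alternating Hägg sequence, `−s k = sigmaOf (k even)`. [folklore] -/
theorem neg_alternatingHagg_eq (x : Site 3) : -alternatingHagg (x 2) = sigmaOf (evenLayer x) := by
  unfold alternatingHagg sigmaOf evenLayer
  by_cases h : x 2 % 2 = 0
  · rw [if_pos (Int.even_iff.2 h)]; simp [h]
  · rw [if_neg (fun he => h (Int.even_iff.1 he))]; simp [h]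

/-- For the alternating Hägg sequence, `s (k − 1) = sigmaOf (k even)`. [folklore] -/
theorem alternatingHagg_pred_eq (x : Site 3) : alternatingHagg (x 2 - 1) = sigmaOf (evenLayer x) := by
  unfold alternatingHagg sigmaOf evenLayer
  by_cases h : x 2 % 2 = 0
  · rw [if_neg (fun he => by have := Int.even_iff.1 he; omega)]; simp [h]
  · rw [if_pos (Int.even_iff.2 (by omega))]; simp [h]

/-- Every hcp bond is a Barlow contact (table check). [folklore] -/
theorem bonds_shell : ∀ e : Bool, ∀ d ∈ bonds e,
    (d 2 = 0 ∧ (-d 0, -d 1) ∈ sixOffsets) ∨ (d 2 = 1 ∧ (-d 0, -d 1) ∈ threeOffsets (sigmaOf e)) ∨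
      (d 2 = -1 ∧ (-d 0, -d 1) ∈ threeOffsets (sigmaOf e)) := by
  decide

/-- Every in-layer Barlow contact is an hcp bond (table check). [folklore] -/
theorem sixOffsets_bonds : ∀ e : Bool, ∀ PQ ∈ sixOffsets, (![-PQ.1, -PQ.2, 0] : Site 3) ∈ bonds e := by decide

/-- Every adjacent-layer Barlow contact is an hcp bond (table check). [folklore] -/
theorem threeOffsets_bonds : ∀ e : Bool, ∀ PQ ∈ threeOffsets (sigmaOf e),
    (![-PQ.1, -PQ.2, 1] : Site 3) ∈ bonds e ∧ (![-PQ.1, -PQ.2, -1] : Site 3) ∈ bonds e := by decide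

/-- **The two adjacency relations agree** under `(i, j, z) ↦ (k, i, j) = (z, i, j)`. [cite: ConwaySloane1999, Ch. 4 §6.1] -/
theorem adj_iff_contact (x y : Site 3) :
    (contactGraph alternatingHagg).Adj (x 2, x 0, x 1) (y 2, y 0, y 1) ↔ hcpGraph.Adj x y := by
  rw [contactGraph_adj_iff isHaggSeq_alternating, hcp_adj_iff, neg_alternatingHagg_eq, alternatingHagg_pred_eq]
  have h0 : x 0 - y 0 = -(y - x) 0 := by simp
  have h1 : x 1 - y 1 = -(y - x) 1 := by simp
  rw [h0, h1]
  constructor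
  · rintro (⟨hk, hm⟩ | ⟨hk, hm⟩ | ⟨hk, hm⟩)
    · have hb := sixOffsets_bonds (evenLayer x) _ hm
      have hd : y - x = ![-(-(y - x) 0), -(-(y - x) 1), 0] := by
        ext i; fin_cases i
        · simp
        · simp
        · simp [hk]
      rw [hd]; exact hb
    · have hb := (threeOffsets_bonds (evenLayer x) _ hm).1
      have hd : y - x = ![-(-(y - x) 0), -(-(y - x) 1), 1] := by
        ext i; fin_cases i
        · simp
        · simp
        · simp [hk]
      rw [hd]; exact hb
    · have hb := (threeOffsets_bonds (evenLayer x) _ hm).2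
      have hd : y - x = ![-(-(y - x) 0), -(-(y - x) 1), -1] := by
        ext i; fin_cases i
        · simp
        · simp
        · simp [hk]
      rw [hd]; exact hb
  · intro hb
    have h2 : (y - x) 2 = y 2 - x 2 := by simp
    rcases bonds_shell (evenLayer x) _ hb with ⟨hk, hm⟩ | ⟨hk, hm⟩ | ⟨hk, hm⟩
    · exact Or.inl ⟨by omega, hm⟩
    · exact Or.inr (Or.inl ⟨by omega, hm⟩)
    · exact Or.inr (Or.inr ⟨by omega, hm⟩)

/-- The relabelling `(i, j, z) ↦ (z, i, j)` of `ℤ³`. [folklore] -/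
def toBarlow : Site 3 ≃ ℤ × ℤ × ℤ where
  toFun x := (x 2, x 0, x 1)
  invFun v := ![v.2.1, v.2.2, v.1]
  left_inv x := by ext i; fin_cases i <;> rfl
  right_inv v := by rfl

/-- `toBarlow x = (x₂, x₀, x₁)`. [folklore] -/
@[simp] theorem toBarlow_apply (x : Site 3) : toBarlow x = (x 2, x 0, x 1) := rfl

/-- **DEFINITION-FAITHFULNESS — the lane's hcp graph IS the contact graph of the hexagonal close packing of unit balls**: the relabelling
`(i, j, z) ↦ (z, i, j)` is a graph isomorphism `Hcp.hcpGraph ≃g Barlow.contactGraph alternatingHagg` (vertices = the balls of the `ABAB…` stacking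
`barlowStacking 1 √(2/3) alternatingHagg` via `Barlow.site`, `Barlow.site_injective`, `Barlow.exists_site_eq`; edges = touching pairs).
[cite: ConwaySloane1999, Ch. 4 §6.1 (the hexagonal close packing)] [cite: HalesDSP2012, §1.3] -/
def contactIso : hcpGraph ≃g contactGraph alternatingHagg where
  toEquiv := toBarlow
  map_rel_iff' := by
    intro x y
    exact adj_iff_contact x y

/-- `contactIso x = (x₂, x₀, x₁)`. [folklore] -/
@[simp] theorem contactIso_apply (x : Site 3) : contactIso x = (x 2, x 0, x 1) := rfl

/-- The alternating sequence is a Hägg sequence (instance form, for the `LocallyFinite` instance below). [folklore] -/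
instance fact_isHaggSeq_alternating : Fact (IsHaggSeq alternatingHagg) := ⟨isHaggSeq_alternating⟩

end Hcp

namespace Barlow

variable {s : ℤ → ℤ}

/-- Instance: the contact graph of a stacking known to be Hägg is locally finite. [folklore] -/
instance instLocallyFinite [h : Fact (IsHaggSeq s)] : (contactGraph s).LocallyFinite := locallyFinite h.out

end Barlow

/-- **TARGET 2t in the metric vocabulary**: `HcpOwnCriticalContinuity` ↔ no percolation at its own critical point on the contact graph of the
hexagonal close packing of unit balls, at every ball. [cite: BenjaminiSchramm1996, Conj. 4] [cite: ConwaySloane1999, Ch. 4 §6.1] -/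
theorem hcpOwnCriticalContinuity_iff_contact :
    HcpOwnCriticalContinuity ↔
      ∀ v : ℤ × ℤ × ℤ, theta (Barlow.contactGraph alternatingHagg) v (criticalProbIOf (Barlow.contactGraph alternatingHagg) v) = 0 := by
  have key : ∀ x : Site 3, theta (Barlow.contactGraph alternatingHagg) (Hcp.contactIso x) (criticalProbIOf (Barlow.contactGraph alternatingHagg)
      (Hcp.contactIso x)) = theta Hcp.hcpGraph x (criticalProbIOf Hcp.hcpGraph x) := by
    intro x
    have hc : criticalProbIOf (Barlow.contactGraph alternatingHagg) (Hcp.contactIso x) = criticalProbIOf Hcp.hcpGraph x :=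
      Subtype.ext (criticalProb_iso Hcp.contactIso x)
    rw [hc, theta_iso]
  constructor
  · intro h v
    obtain ⟨x, rfl⟩ := Hcp.contactIso.surjective v
    rw [key]; exact h x
  · intro h x
    rw [← key]; exact h _


end Summit.CriticalPhenomena.PercolationContinuityZ3.Theorems.Transplant

end
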